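import Literature.Geometry.Lorentzian.KissingBallsCutMass
import Literature.Geometry.Lorentzian.MetricValCongr
import Literature.Geometry.Riemannian.GaussBonnet
import Literature.Geometry.Riemannian.ChangGurskyYangProofs
import Literature.Topology.Euclidean.PoincareHopfLevelSurface
import HarnessLib

/-!
# Stub `stub_minkowskiSectionArea` of line `birth` of crux `HorizonlessMustDrain`
# (stmt-FinalStateConjecture-9976): the round section of radius `r` of the Minkowski light cone
# has area `4πr²`

This file proves the registered stub `stub_minkowskiSectionArea` (S3) of
`Summits/FinalStateConjecture/FinalStateConjecture/Cruxes/HorizonlessMustDrain/Lines/birth.lean`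
(verbatim): in the Minkowski development `Minkowski.vacuumCauchyDevelopment` of the trivial datum,
for every `r > 0` and every proof `hf` that the round section `y ↦ (r, r y)` of the unit sphere
`S² ⊆ ℝ³` is a spacelike immersion, its area
`surfaceArea = totalArea (inducedRiemannianMetric …) = riemannianVolume _ 2 univ` (the
Euclidean-normalised `2`-dimensional Hausdorff measure of the induced length metric,
`Literature/Geometry/Lorentzian/Volume.lean`, `CutBondiMass.lean`) equals `ENNReal.ofReal (4πr²)`.

Proof (chart-free, through the tree's PROVED Gauss–Bonnet theorem).

1. `mfderiv_section`: the differential of `y ↦ (r, r y)` is `v ↦ (0, r dι v)`, `ι : S² ↪ ℝ³`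
   (chain rule through the affine representative `x ↦ (r, r x)` of `ℝ³ → ℝ⁴`).
2. `inducedBilin_section`: hence the induced first fundamental form is
   `η((0, r dι v), (0, r dι w)) = r² ⟪dι v, dι w⟫ = r² · g_round(v, w)`
   (`Minkowski.bilin_ofTimeSpace_zero`, `roundMetric_apply`), i.e. the induced metric has the same
   values as the constant rescaling `(roundMetric ℝ³).constSmul (r²)` of the round metric.
3. `scalarCurvature_section`: curvature quantities only depend on the values of the metric
   (`scalarCurvature_congr_of_val_eq`), `S(c g) = c⁻¹ S(g)` (`scalarCurvature_constSmul`) and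
   `S(S²_round) = 2 · 1` (`scalarCurvature_roundMetric`), so the induced metric has constant
   scalar curvature `2/r²`.
4. Gauss–Bonnet (`integral_scalarCurvature_eq_relEuler`, `Riemannian/GaussBonnet.lean`) with
   `χ(S²) = 2` (`finRelHomology_sphere_two`): `∫ 2/r² dA = 4π · 2`, so `|S| · 2/r² = 8π`, i.e.
   `|S| = 4πr²`; the area measure of the compact sphere is finite
   (`riemannianVolume_lt_top_of_isCompact_holds`), whence the `ℝ≥0∞` form.

No named facts are used and no definitions are introduced.  References: O'Neill 1983, Ch. 4,
p. 97 (induced metric) and Lemma 4.27 (round spheres); Lee 2018, Thm. 9.7 (Gauss–Bonnet) and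
Prop. 8.36 (`S = n(n-1)` for the round sphere); Federer 1969, §3.2.46 (Hausdorff measure of a
Riemannian manifold); Christodoulou–Klainerman 1993, Ch. 17, (17.0.2) (`r = √(|S|/4π)`).
-/

-- the doubled `FinalStateConjecture.FinalStateConjecture` path component trips dupNamespace
set_option linter.dupNamespace false

noncomputable section

open scoped Manifold ContDiff Topology RealInnerProductSpace ENNReal
open Set Metric MeasureTheory Bundle Module
open Literature.Geometry.Lorentzian Literature.Geometry.Riemannian
open Literature.Geometry.Lorentzian.PseudoRiemannianMetric

namespace Summit.FinalStateConjecture.FinalStateConjecture.Theorems.BondiDrainDispersalHorizonlessMustDrain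

namespace StubMinkowskiSectionArea

/-- The affine representative `x ↦ (r, r x)` of the section, `ℝ³ → ℝ⁴`, has derivative
`v ↦ (0, r v)` everywhere. [folklore] -/
theorem hasFDerivAt_sectionRep (r : ℝ) (x : E3) :
    HasFDerivAt (fun x : E3 ↦ E4.ofTimeSpace r (r • x))
      ((LinearMap.toContinuousLinearMap
          (IsLinearMap.mk' _ Minkowski.isLinearMap_ofTimeSpace_zero)).comp
        (r • ContinuousLinearMap.id ℝ E3)) x := by
  set L : E3 →L[ℝ] E4 :=
    LinearMap.toContinuousLinearMap (IsLinearMap.mk' _ Minkowski.isLinearMap_ofTimeSpace_zero)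
  have hcoe : ∀ w : E3, L w = E4.ofTimeSpace 0 w := fun _ ↦ rfl
  have heq : (fun x : E3 ↦ E4.ofTimeSpace r (r • x)) =
      fun x : E3 ↦ E4.ofTimeSpace r 0 + L (r • x) := by
    funext x
    rw [hcoe]
    ext i
    refine Fin.cases ?_ (fun j ↦ ?_) i <;> simp
  rw [heq]
  exact (L.hasFDerivAt.comp x ((hasFDerivAt_id x).const_smul r)).const_add (E4.ofTimeSpace r 0)

/-- **The differential of the round section** `y ↦ (r, r y)` of `S²` in Minkowski spacetime:
`d(sec)_y v = (0, r dι_y v)`, `ι : S² ↪ ℝ³` the inclusion. [folklore] -/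
theorem mfderiv_section (r : ℝ) (y : sphere (0 : E3) 1) (v : TangentSpace (𝓡 2) y) :
    mfderiv (𝓡 2) 𝓘(ℝ, E4)
        (fun y : sphere (0 : E3) 1 ↦ E4.ofTimeSpace r (r • (y : E3))) y v =
      E4.ofTimeSpace 0
        (r • (mfderiv (𝓡 2) 𝓘(ℝ, E3) ((↑) : sphere (0 : E3) 1 → E3) y v : E3)) := by
  -- `dim ℝ³ = 2 + 1`, the `Fact` under which Mathlib's sphere API sees `S² ⊆ ℝ³`
  haveI : Fact (finrank ℝ E3 = 2 + 1) := ⟨by simp⟩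
  have hS : MDifferentiableAt (𝓡 2) 𝓘(ℝ, E3) (Subtype.val : sphere (0 : E3) 1 → E3) y :=
    (contMDiff_coe_sphere (m := 1) (n := 2) y).mdifferentiableAt one_ne_zero
  have h : HasMFDerivAt (𝓡 2) 𝓘(ℝ, E4)
      ((fun x : E3 ↦ E4.ofTimeSpace r (r • x)) ∘ (Subtype.val : sphere (0 : E3) 1 → E3)) y
      (((LinearMap.toContinuousLinearMap
          (IsLinearMap.mk' _ Minkowski.isLinearMap_ofTimeSpace_zero)).comp
        (r • ContinuousLinearMap.id ℝ E3)).comp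
        (mfderiv (𝓡 2) 𝓘(ℝ, E3) (Subtype.val : sphere (0 : E3) 1 → E3) y)) :=
    (hasFDerivAt_sectionRep r (y : E3)).hasMFDerivAt.comp y hS.hasMFDerivAt
  change mfderiv (𝓡 2) 𝓘(ℝ, E4)
    ((fun x : E3 ↦ E4.ofTimeSpace r (r • x)) ∘ (Subtype.val : sphere (0 : E3) 1 → E3)) y v =
    _
  rw [h.mfderiv]
  rfl

/-- **The induced first fundamental form of the round section is `r²` times the round metric**:
`η(d(sec)_y v, d(sec)_y w) = r² ⟪dι_y v, dι_y w⟫` (`= r² g_round(v, w)`, `roundMetric_apply`).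
O'Neill 1983, Ch. 4, p. 97 and Lemma 4.27. [folklore] -/
theorem inducedBilin_section (r : ℝ) (y : sphere (0 : E3) 1) (v w : TangentSpace (𝓡 2) y) :
    Minkowski.vacuumCauchyDevelopment.toCauchyDevelopment.metric.inducedBilin (𝓡 2)
        (fun y : sphere (0 : E3) 1 ↦ E4.ofTimeSpace r (r • (y : E3))) y v w =
      r ^ 2 * ⟪(mfderiv (𝓡 2) 𝓘(ℝ, E3) ((↑) : sphere (0 : E3) 1 → E3) y v : E3),
        (mfderiv (𝓡 2) 𝓘(ℝ, E3) ((↑) : sphere (0 : E3) 1 → E3) y w : E3)⟫ := by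
  change Minkowski.bilin
      (mfderiv (𝓡 2) 𝓘(ℝ, E4)
        (fun y : sphere (0 : E3) 1 ↦ E4.ofTimeSpace r (r • (y : E3))) y v)
      (mfderiv (𝓡 2) 𝓘(ℝ, E4)
        (fun y : sphere (0 : E3) 1 ↦ E4.ofTimeSpace r (r • (y : E3))) y w) = _
  rw [mfderiv_section, mfderiv_section, Minkowski.bilin_ofTimeSpace_zero]
  -- the values of `dι` live in the synonym `TangentSpace 𝓘(ℝ, E3) y`: compute on honest vectors
  have key : ∀ a b : E3, ⟪r • a, r • b⟫ = r ^ 2 * ⟪a, b⟫ := fun a b ↦ by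
    rw [real_inner_smul_left, real_inner_smul_right]
    ring
  exact key _ _

/-- **The induced metric of the round section of radius `r` has scalar curvature `2/r²`**: it has
the values of `r² g_round` (`inducedBilin_section`), curvature only depends on the values
(`scalarCurvature_congr_of_val_eq`), `S(c g) = c⁻¹ S(g)` and `S(g_round) = 2` on `S²`. Lee 2018,
Prop. 8.36; O'Neill 1983, Ch. 4, Lemma 4.27. [folklore] -/
theorem scalarCurvature_section (r : ℝ) (hr : 0 < r)
    (hf : Minkowski.vacuumCauchyDevelopment.toCauchyDevelopment.metric.IsSpacelikeImmersion (𝓡 2)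
      (fun y : sphere (0 : E3) 1 ↦ E4.ofTimeSpace r (r • (y : E3))))
    [(ofRiemannian
      (Minkowski.vacuumCauchyDevelopment.toCauchyDevelopment.metric.inducedRiemannianMetric
        (fun y : sphere (0 : E3) 1 ↦ E4.ofTimeSpace r (r • (y : E3)))
        contMDiff_pullbackBilin_holds hf)).HasLeviCivita]
    (y : sphere (0 : E3) 1) :
    (ofRiemannian
      (Minkowski.vacuumCauchyDevelopment.toCauchyDevelopment.metric.inducedRiemannianMetric
        (fun y : sphere (0 : E3) 1 ↦ E4.ofTimeSpace r (r • (y : E3)))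
        contMDiff_pullbackBilin_holds hf)).scalarCurvature y = 2 / r ^ 2 := by
  -- `dim ℝ³ = 2 + 1`, the `Fact` under which `roundMetric E3` is the round metric of `S² ⊆ ℝ³`
  haveI : Fact (finrank ℝ E3 = 2 + 1) := ⟨by simp⟩
  have hr2 : r ^ 2 ≠ 0 := by positivity
  haveI : (roundMetric (n := 2) E3).HasLeviCivita := (roundMetric (n := 2) E3).hasLeviCivita
  haveI : ((roundMetric (n := 2) E3).constSmul (r ^ 2) hr2).HasLeviCivita :=
    HasLeviCivita.constSmul _ _
  have hval : ∀ x,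
      (ofRiemannian
        (Minkowski.vacuumCauchyDevelopment.toCauchyDevelopment.metric.inducedRiemannianMetric
          (fun y : sphere (0 : E3) 1 ↦ E4.ofTimeSpace r (r • (y : E3)))
          contMDiff_pullbackBilin_holds hf)).val x =
        ((roundMetric (n := 2) E3).constSmul (r ^ 2) hr2).val x := by
    intro x
    ext v w
    change Minkowski.vacuumCauchyDevelopment.toCauchyDevelopment.metric.inducedBilin (𝓡 2)
        (fun y : sphere (0 : E3) 1 ↦ E4.ofTimeSpace r (r • (y : E3))) x v w = _
    rw [constSmul_apply, roundMetric_apply]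
    exact inducedBilin_section r x v w
  rw [scalarCurvature_congr_of_val_eq hval y, scalarCurvature_constSmul,
    scalarCurvature_roundMetric]
  field_simp
  norm_num

end StubMinkowskiSectionArea

open StubMinkowskiSectionArea in
/-- **S3 — THE AREA OF THE SECTION OF RADIUS `r` IS `4πr²`.** In the Minkowski development of the
trivial datum, the area (`LorentzianMetric.surfaceArea`: total `2`-dimensional Euclidean-normalised
Hausdorff measure of the induced length metric) of the round section `y ↦ (r, r y)`, `y ∈ S²`, of
the light cone of the origin is `4πr²`, for every `r > 0` and every proof `hf` of spacelikeness.
Proof: the induced metric has constant scalar curvature `2/r²` (`scalarCurvature_section`), and the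
PROVED Gauss–Bonnet theorem `∫ S dA = 4π χ(S²) = 8π` (`integral_scalarCurvature_eq_relEuler`,
`finRelHomology_sphere_two`) gives `|S| · 2/r² = 8π`. Federer 1969, §3.2.46; Lee 2018, Thm. 9.7;
Christodoulou–Klainerman 1993, Ch. 17, (17.0.2). [folklore] -/
theorem stub_minkowskiSectionArea : open scoped Manifold in
    ∀ r : ℝ, 0 < r →
      ∀ hf : Literature.Geometry.Lorentzian.Minkowski.vacuumCauchyDevelopment.toCauchyDevelopment.metric.IsSpacelikeImmersion
          (𝓡 2) (fun y : Metric.sphere (0 : Literature.Geometry.Lorentzian.E3) 1 ↦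
            Literature.Geometry.Lorentzian.E4.ofTimeSpace r (r • (y : Literature.Geometry.Lorentzian.E3))),
        Literature.Geometry.Lorentzian.Minkowski.vacuumCauchyDevelopment.toCauchyDevelopment.metric.surfaceArea
            (fun y : Metric.sphere (0 : Literature.Geometry.Lorentzian.E3) 1 ↦
              Literature.Geometry.Lorentzian.E4.ofTimeSpace r (r • (y : Literature.Geometry.Lorentzian.E3))) hf =
          ENNReal.ofReal (4 * Real.pi * r ^ 2) := by
  intro r hr hf
  -- the area is the total `2`-dimensional Riemannian volume of the induced metric (by `rfl`)
  show riemannianVolume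
      (Minkowski.vacuumCauchyDevelopment.toCauchyDevelopment.metric.inducedRiemannianMetric
        (fun y : sphere (0 : E3) 1 ↦ E4.ofTimeSpace r (r • (y : E3)))
        contMDiff_pullbackBilin_holds hf) 2 univ =
    ENNReal.ofReal (4 * Real.pi * r ^ 2)
  haveI : (ofRiemannian
      (Minkowski.vacuumCauchyDevelopment.toCauchyDevelopment.metric.inducedRiemannianMetric
        (fun y : sphere (0 : E3) 1 ↦ E4.ofTimeSpace r (r • (y : E3)))
        contMDiff_pullbackBilin_holds hf)).HasLeviCivita :=
    PseudoRiemannianMetric.hasLeviCivita _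
  -- Gauss–Bonnet on the sphere, `χ(S²) = 2`
  have hGB := integral_scalarCurvature_eq_relEuler
    (Minkowski.vacuumCauchyDevelopment.toCauchyDevelopment.metric.inducedRiemannianMetric
      (fun y : sphere (0 : E3) 1 ↦ E4.ofTimeSpace r (r • (y : E3)))
      contMDiff_pullbackBilin_holds hf)
  have hχ :
      (Literature.AlgebraicTopology.SingularHomology.relEuler ℤ ℤ (sphere (0 : E3) 1) ∅ : ℝ) = 2 := by
    exact_mod_cast Literature.Topology.Euclidean.finRelHomology_sphere_two.2
  -- constant scalar curvature `2/r²`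
  simp_rw [scalarCurvature_section r hr hf] at hGB
  rw [integral_const, smul_eq_mul, hχ] at hGB
  -- `|S| · 2/r² = 8π`, so `|S| = 4πr²`
  have hr2 : (r ^ 2 : ℝ) ≠ 0 := by positivity
  have hreal : (riemannianVolume
      (Minkowski.vacuumCauchyDevelopment.toCauchyDevelopment.metric.inducedRiemannianMetric
        (fun y : sphere (0 : E3) 1 ↦ E4.ofTimeSpace r (r • (y : E3)))
        contMDiff_pullbackBilin_holds hf) 2).real univ = 4 * Real.pi * r ^ 2 := by
    field_simp at hGB
    linarith
  -- the area measure of the compact sphere is finite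
  have hfin : riemannianVolume
      (Minkowski.vacuumCauchyDevelopment.toCauchyDevelopment.metric.inducedRiemannianMetric
        (fun y : sphere (0 : E3) 1 ↦ E4.ofTimeSpace r (r • (y : E3)))
        contMDiff_pullbackBilin_holds hf) 2 univ < ⊤ :=
    riemannianVolume_lt_top_of_isCompact_holds _ (by simp) isCompact_univ
  rw [← ENNReal.ofReal_toReal hfin.ne]
  exact congrArg ENNReal.ofReal hreal

end Summit.FinalStateConjecture.FinalStateConjecture.Theorems.BondiDrainDispersalHorizonlessMustDrain
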